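import Literature.NumberTheory.LFunctions.Zhang2022.TerminalBlockIIS

/-!
# Zhang (2022): the terminal block — minimal IIS covers (repair sets) and maximal feasible subsystems

Trunk T-ANT (NumberTheory/LFunctions). Y. Zhang, *Discrete mean estimates and the Landau–Siegel
zero*, arXiv:2211.02515v1 (2022) [Zhang2022LandauSiegel] — an unrefereed manuscript under
adjudication (cell pub-zhang: audit + repair census; **no claim about Landau–Siegel**). **Nothing in
this file asserts or denies its Theorems 1–2, its Propositions 2.1–2.6, 14.1, or any analytic
lemma.** It is the companion of `TerminalBlockIIS` (the cell's sweep seat 2, row S2-12/S2-13: the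
terminal block of the constraint file `sweep/CONSTRAINTS-v7.json` = v8 = v9 — 19 rows over the four
free thresholds `thr24 thr25 thr232 thr233` ↦ `d24 c25 q232 cJ`, every other name at its certified
file value — has exactly 372 minimal infeasible subsystems, the transversals of five role patterns).

Here the DUAL object is computed (row S2-14 of the cell's binding-constraint map): the **IIS covers**
("repair sets") — the sets `H` of terminal rows whose deletion leaves a system satisfiable over ℝ⁴
(`IsCover H := Feasible (univ \ H)`) — and the inclusion-minimal ones, whose complements are the
MAXIMAL FEASIBLE SUBSYSTEMS. What is proved (real arithmetic is entirely inherited from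
`TerminalBlockIIS.not_feasible_iff_hasPattern`; this file is finite combinatorics on top of it):

* `isCover_iff_forall_not_feasible`, `isCover_iff_forall_minimalIIS`: textbook duality — a set of
  rows is a cover iff it meets every infeasible subsystem iff it meets every one of the 372 minimal
  infeasible subsystems (`exists_minimalIIS_subset`: every infeasible subsystem contains a minimal one);
* `isCover_iff_isRoleCover`: `H` is a cover iff the set of roles ALL of whose rows lie in `H`
  (`fullRoles H`) meets each of the five patterns E1–E5;
* `isMinimalRoleCover_iff`: the inclusion-minimal role sets meeting every pattern are EXACTLY the eight
  sets `RC1 = {L232}`, `RC2 = {L233}`, `RC3 = {AL, AS}`, `RC4 = {C, Sq}`, `RC5 = {T, Sq}`,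
  `RC6 = {S, Sq}`, `RC7 = {AS, P24, T}`, `RC8 = {AS, P24, S}` (the complements of the eight maximal
  pattern-free role sets served by the witnesses `W1`–`W7`, `printed` of `TerminalBlockIIS`);
* `isMinimalCover_iff`, `mem_minimalCovers_iff`, `card_minimalCovers`: the minimal covers at ROW
  level are exactly the eight sets "all rows of the roles of some `RCk`" (`rowsOf_roleCovers` lists
  them: the three certified (2.32)-floor rows; the four (2.33) rows; the three caps on thr24; the two
  Cauchy–Schwarz couplings with the square row; the two assembly rows with the square row; the two
  sign rows with the square row; and two 5-row sets through both square caps and `thr24 > 0`), of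
  sizes 3, 4, 3, 3, 3, 3, 5, 5 — so every cover has at least three rows (`three_le_card_of_isCover`),
  every cover CONTAINS all rows of one of the eight (`exists_rowsOf_subset`), and `III-18.02b` (the
  manuscript's own value 0.0008 of (18.2)) lies in no minimal cover (`not_mem_of_isMinimalCover`);
* `isMaximalFeasible_iff`: dually, the maximal feasible subsystems are exactly the eight complements.

Reading for the repair census (interpretation, not a theorem): to make the cell's transcription of
the §2 endgame bookkeeping consistent again one must give up ALL rows of one of these eight groups —
e.g. every certified lower bound for the (2.32) main term, or every (2.33) row, or every cap on
`|𝔡′+𝔡|` (Prop. 2.4), or Prop. 2.5's coupling in both typings — never a single row. Consistency of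
rows, never truth of inputs; the certified constants are the literals of `TerminalBlockIIS`.

[cite: Zhang2022LandauSiegel, §2 (2.18)–(2.19), (2.32)–(2.33), Props. 2.4–2.5, §10 (10.17), §18
(18.2)–(18.3)]
-/

noncomputable section

namespace Literature.NumberTheory.LFunctions.Zhang2022

namespace TerminalBlock

/-! ## Covers (repair sets) -/

/-- `IsCover H`: deleting the rows `H` from the full 19-row terminal block leaves a system that is
satisfiable over ℝ⁴ (an "IIS cover" / repair set). [folklore] -/
def IsCover (H : Finset Row) : Prop := Feasible (Finset.univ \ H)

/-- `IsMinimalCover H`: a cover none of whose drop-one subsets is a cover. [folklore] -/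
def IsMinimalCover (H : Finset Row) : Prop := IsCover H ∧ ∀ r ∈ H, ¬ IsCover (H.erase r)

/-- `IsMaximalFeasible S`: a feasible subsystem that becomes infeasible when any further terminal
row is added. [folklore] -/
def IsMaximalFeasible (S : Finset Row) : Prop := Feasible S ∧ ∀ r ∉ S, ¬ Feasible (insert r S)

/-- Supersets of covers are covers. [folklore] -/
theorem isCover_mono {H H' : Finset Row} (h : H ⊆ H') (hH : IsCover H) : IsCover H' := by
  refine feasible_mono (fun r hr => ?_) hH
  rw [Finset.mem_sdiff] at hr ⊢
  exact ⟨hr.1, fun h' => hr.2 (h h')⟩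

/-- **Duality, general form.** `H` is a cover iff it meets every infeasible subsystem. [folklore] -/
theorem isCover_iff_forall_not_feasible (H : Finset Row) :
    IsCover H ↔ ∀ S : Finset Row, ¬ Feasible S → (S ∩ H).Nonempty := by
  constructor
  · intro hH S hS
    by_contra hSH
    apply hS
    refine feasible_mono (fun r hr => ?_) hH
    rw [Finset.mem_sdiff]
    exact ⟨Finset.mem_univ r, fun hrH => hSH ⟨r, Finset.mem_inter.mpr ⟨hr, hrH⟩⟩⟩
  · intro h
    by_contra hH
    obtain ⟨r, hr⟩ := h _ hH
    rw [Finset.mem_inter, Finset.mem_sdiff] at hr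
    exact hr.1.2 hr.2

/-- Every infeasible subsystem contains a minimal infeasible subsystem (a transversal of the pattern
its roles contain, chosen inside it).
[cite: Zhang2022LandauSiegel, §2 (2.18)–(2.19), Props. 2.4–2.5, (2.32)–(2.33)] -/
theorem exists_minimalIIS_subset {S : Finset Row} (hS : ¬ Feasible S) :
    ∃ M ∈ minimalIISs, M ⊆ S := by
  obtain ⟨e, he, hsub⟩ := (not_feasible_iff_hasPattern S).mp hS
  have hex : ∀ x ∈ e, ∃ r ∈ S, r.role = x := fun x hx => Finset.mem_image.mp (hsub hx)
  choose f hfS hfrole using hex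
  refine ⟨sectionImage e f, ?_, ?_⟩
  · rw [mem_minimalIISs_iff, isMinimalIIS_iff_mem_transversals]
    exact ⟨e, he, Finset.mem_image.mpr
      ⟨f, Finset.mem_pi.mpr fun x hx => mem_fibre.mpr (hfrole x hx), rfl⟩⟩
  · intro r hr
    simp only [sectionImage, Finset.mem_image, Finset.mem_attach, true_and, Subtype.exists] at hr
    obtain ⟨x, hx, rfl⟩ := hr
    exact hfS x hx

/-- **Duality with the IIS catalogue.** `H` is a cover iff it meets every one of the 372 minimal
infeasible subsystems (`minimalIISs`, `card_minimalIISs`).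
[cite: Zhang2022LandauSiegel, §2 (2.18)–(2.19), Props. 2.4–2.5, (2.32)–(2.33)] -/
theorem isCover_iff_forall_minimalIIS (H : Finset Row) :
    IsCover H ↔ ∀ M ∈ minimalIISs, (M ∩ H).Nonempty := by
  rw [isCover_iff_forall_not_feasible]
  constructor
  · intro h M hM
    exact h M ((mem_minimalIISs_iff M).mp hM).1
  · intro h S hS
    obtain ⟨M, hM, hMS⟩ := exists_minimalIIS_subset hS
    obtain ⟨r, hr⟩ := h M hM
    rw [Finset.mem_inter] at hr
    exact ⟨r, Finset.mem_inter.mpr ⟨hMS hr.1, hr.2⟩⟩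

/-! ## Role level -/

/-- The roles ALL of whose rows lie in `H` (only a role removed entirely disappears from the
complementary system). [folklore] -/
def fullRoles (H : Finset Row) : Finset Role := Finset.univ.filter fun x => fibre x ⊆ H

/-- Membership in `fullRoles`. [folklore] -/
theorem mem_fullRoles {H : Finset Row} {x : Role} :
    x ∈ fullRoles H ↔ ∀ r : Row, r.role = x → r ∈ H := by
  simp only [fullRoles, Finset.mem_filter, Finset.mem_univ, true_and, Finset.subset_iff, mem_fibre]

/-- One row of each role (every role of the terminal block is inhabited).
[cite: Zhang2022LandauSiegel, §2, §10 (10.17), §18 (18.2)–(18.3)] -/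
def someRow : Role → Row
  | .AL => .N_II_10_17a
  | .AS => .N_P2_4s
  | .P24 => .I_P2_4a
  | .T => .I_T9a
  | .C => .I_2_32a
  | .S => .I_P2_5a
  | .Sq => .N_P2_5s
  | .L232 => .N_2_32Gs
  | .L232p => .III_18_02b
  | .L233 => .N_2_33s

/-- `someRow x` has role `x`. [cite: Zhang2022LandauSiegel, §2, §10 (10.17), §18 (18.2)–(18.3)] -/
@[simp] theorem role_someRow (x : Role) : (someRow x).role = x := by
  cases x <;> rfl

/-- The roles of the complementary system are the complement of the full roles. [folklore] -/
theorem roles_univ_sdiff (H : Finset Row) :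
    roles (Finset.univ \ H) = Finset.univ \ fullRoles H := by
  ext x
  simp only [roles, Finset.mem_image, Finset.mem_sdiff, Finset.mem_univ, true_and, mem_fullRoles]
  constructor
  · rintro ⟨r, hrH, hrx⟩ hall
    exact hrH (hall r hrx)
  · intro h
    by_contra h'
    apply h
    intro r hrx
    by_contra hrH
    exact h' ⟨r, hrH, hrx⟩

/-- `IsRoleCover R`: the complementary role set is pattern-free, i.e. `R` meets every pattern.
[cite: Zhang2022LandauSiegel, §2 (2.18)–(2.19), Props. 2.4–2.5, (2.32)–(2.33)] -/
def IsRoleCover (R : Finset Role) : Prop := ¬ HasPattern (Finset.univ \ R)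

/-- `IsRoleCover` is decidable. [folklore] -/
instance : DecidablePred IsRoleCover := fun R => by
  unfold IsRoleCover; infer_instance

/-- `IsMinimalRoleCover R`: a role cover none of whose drop-one subsets is one. [folklore] -/
def IsMinimalRoleCover (R : Finset Role) : Prop :=
  IsRoleCover R ∧ ∀ x ∈ R, ¬ IsRoleCover (R.erase x)

/-- `IsMinimalRoleCover` is decidable. [folklore] -/
instance : DecidablePred IsMinimalRoleCover := fun R => by
  unfold IsMinimalRoleCover; infer_instance

/-- A role cover is a role set meeting each of the five patterns.
[cite: Zhang2022LandauSiegel, §2 (2.18)–(2.19), Props. 2.4–2.5, (2.32)–(2.33)] -/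
theorem isRoleCover_iff (R : Finset Role) : IsRoleCover R ↔ ∀ e ∈ patterns, ∃ x ∈ e, x ∈ R := by
  constructor
  · intro h e he
    by_contra hne
    exact h ⟨e, he, fun x hx => Finset.mem_sdiff.mpr ⟨Finset.mem_univ x, fun hxR => hne ⟨x, hx, hxR⟩⟩⟩
  · rintro h ⟨e, he, hsub⟩
    obtain ⟨x, hxe, hxR⟩ := h e he
    exact (Finset.mem_sdiff.mp (hsub hxe)).2 hxR

/-- Supersets of role covers are role covers. [folklore] -/
theorem isRoleCover_mono {R R' : Finset Role} (h : R ⊆ R') (hR : IsRoleCover R) : IsRoleCover R' := by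
  refine fun hp => hR (hasPattern_mono (fun x hx => ?_) hp)
  rw [Finset.mem_sdiff] at hx ⊢
  exact ⟨hx.1, fun h' => hx.2 (h h')⟩

/-- **Covers, read on roles.** `H` is a cover iff its full roles form a role cover.
[cite: Zhang2022LandauSiegel, §2 (2.18)–(2.19), Props. 2.4–2.5, (2.32)–(2.33)] -/
theorem isCover_iff_isRoleCover (H : Finset Row) : IsCover H ↔ IsRoleCover (fullRoles H) := by
  rw [IsCover, feasible_iff_not_hasPattern, roles_univ_sdiff]
  rfl

/-! ## The eight minimal role covers -/

/-- RC1 = {L232}: every certified lower bound for the (2.32) constant.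
[cite: Zhang2022LandauSiegel, (2.32), §18 (18.2)] -/
def RC1 : Finset Role := {.L232}
/-- RC2 = {L233}: every (2.33) row. [cite: Zhang2022LandauSiegel, (2.33), §18 (18.3)] -/
def RC2 : Finset Role := {.L233}
/-- RC3 = {AL, AS}: every cap on thr24 = |𝔡′+𝔡| (Prop. 2.4, linear and square typing).
[cite: Zhang2022LandauSiegel, Prop. 2.4, §10 (10.17)] -/
def RC3 : Finset Role := {.AL, .AS}
/-- RC4 = {C, Sq}: Prop. 2.5's coupling thr232·thr233 < thr25² together with the square typing
thr232·thr233 < thr24². [cite: Zhang2022LandauSiegel, Prop. 2.5, (2.32)–(2.33)] -/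
def RC4 : Finset Role := {.C, .Sq}
/-- RC5 = {T, Sq}: the assembly rows thr25 < thr24 ((2.18) with Props. 2.4–2.6) together with the
square typing. [cite: Zhang2022LandauSiegel, §2 (2.18)–(2.19)] -/
def RC5 : Finset Role := {.T, .Sq}
/-- RC6 = {S, Sq}: the sign rows thr25 > 0 together with the square typing.
[cite: Zhang2022LandauSiegel, §2 (2.19), Prop. 2.5] -/
def RC6 : Finset Role := {.S, .Sq}
/-- RC7 = {AS, P24, T}: both square caps, thr24 > 0 and the assembly rows.
[cite: Zhang2022LandauSiegel, §2 (2.18), Prop. 2.4] -/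
def RC7 : Finset Role := {.AS, .P24, .T}
/-- RC8 = {AS, P24, S}: both square caps, thr24 > 0 and the sign rows.
[cite: Zhang2022LandauSiegel, §2 (2.19), Props. 2.4–2.5] -/
def RC8 : Finset Role := {.AS, .P24, .S}

/-- The list of the eight minimal role covers.
[cite: Zhang2022LandauSiegel, §2 (2.18)–(2.19), Props. 2.4–2.5, (2.32)–(2.33)] -/
def roleCovers : List (Finset Role) := [RC1, RC2, RC3, RC4, RC5, RC6, RC7, RC8]

/-- Each of the eight is a minimal role cover (decidable finite check).
[cite: Zhang2022LandauSiegel, §2 (2.18)–(2.19), Props. 2.4–2.5, (2.32)–(2.33)] -/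
theorem roleCovers_minimal : ∀ R ∈ roleCovers, IsMinimalRoleCover R := by
  simp only [roleCovers, List.mem_cons, List.not_mem_nil, or_false, forall_eq_or_imp, forall_eq]
  simp [IsMinimalRoleCover, IsRoleCover, hasPattern_iff, RC1, RC2, RC3, RC4, RC5, RC6, RC7, RC8,
    Finset.mem_erase]

/-- The eight are pairwise distinct. [folklore] -/
theorem roleCovers_nodup : roleCovers.Nodup := by
  decide

/-- **Completeness.** Every role cover contains one of the eight: meeting E3 = {AS, Sq, L232, L233}
forces L232, L233, Sq or AS; with Sq, meeting E1/E2 forces T, C, S or both AL and AS; with AS but not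
Sq, meeting E4 forces AL or P24, and then meeting E5 forces AL, T or S.
[cite: Zhang2022LandauSiegel, §2 (2.18)–(2.19), Props. 2.4–2.5, (2.32)–(2.33)] -/
theorem exists_roleCover_subset {R : Finset Role} (h : IsRoleCover R) : ∃ C ∈ roleCovers, C ⊆ R := by
  rw [isRoleCover_iff] at h
  have h1 := h E1 (by simp [patterns])
  have h2 := h E2 (by simp [patterns])
  have h3 := h E3 (by simp [patterns])
  have h4 := h E4 (by simp [patterns])
  have h5 := h E5 (by simp [patterns])
  clear h
  simp only [E1, E2, E3, E4, E5, Finset.mem_insert, Finset.mem_singleton, exists_eq_or_imp,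
    exists_eq_left] at h1 h2 h3 h4 h5
  simp only [roleCovers, RC1, RC2, RC3, RC4, RC5, RC6, RC7, RC8, List.mem_cons, List.not_mem_nil,
    or_false, exists_eq_or_imp, exists_eq_left, Finset.insert_subset_iff,
    Finset.singleton_subset_iff]
  by_cases h232 : Role.L232 ∈ R
  · exact Or.inl h232
  by_cases h233 : Role.L233 ∈ R
  · exact Or.inr (Or.inl h233)
  simp only [h232, h233, or_false] at h1 h2 h3 h4 h5
  -- h1 : AL ∨ T ∨ C ∨ S;  h2 : AS ∨ T ∨ C ∨ S;  h3 : AS ∨ Sq;  h4 : AL ∨ P24 ∨ Sq;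
  -- h5 : AL ∨ T ∨ S ∨ Sq  (memberships in R)
  by_cases hSq : Role.Sq ∈ R
  · rcases h1 with hAL | hT | hC | hS
    · rcases h2 with hAS | hT | hC | hS
      · simp [hAL, hAS]
      · simp [hT, hSq]
      · simp [hC, hSq]
      · simp [hS, hSq]
    · simp [hT, hSq]
    · simp [hC, hSq]
    · simp [hS, hSq]
  · simp only [hSq, or_false] at h3 h4 h5
    -- h3 : AS;  h4 : AL ∨ P24;  h5 : AL ∨ T ∨ S
    rcases h4 with hAL | hP24
    · simp [hAL, h3]
    · rcases h5 with hAL | hT | hS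
      · simp [hAL, h3]
      · simp [h3, hP24, hT]
      · simp [h3, hP24, hS]

/-- **The minimal role covers are exactly the eight listed.**
[cite: Zhang2022LandauSiegel, §2 (2.18)–(2.19), Props. 2.4–2.5, (2.32)–(2.33)] -/
theorem isMinimalRoleCover_iff (R : Finset Role) : IsMinimalRoleCover R ↔ R ∈ roleCovers := by
  constructor
  · rintro ⟨hR, hmin⟩
    obtain ⟨C, hC, hCR⟩ := exists_roleCover_subset hR
    suffices hRC : R = C by rw [hRC]; exact hC
    by_contra hne
    have hnot : ¬ R ⊆ C := fun h' => hne (Finset.Subset.antisymm h' hCR)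
    obtain ⟨x, hxR, hxC⟩ := Finset.not_subset.mp hnot
    refine hmin x hxR (isRoleCover_mono (fun y hy => ?_) (roleCovers_minimal C hC).1)
    exact Finset.mem_erase.mpr ⟨fun hyx => hxC (hyx ▸ hy), hCR hy⟩
  · exact roleCovers_minimal R

/-! ## Row level: the eight minimal covers -/

/-- All rows whose role lies in `R`. [folklore] -/
def rowsOf (R : Finset Role) : Finset Row := Finset.univ.filter fun r => r.role ∈ R

/-- Membership in `rowsOf`. [folklore] -/
@[simp] theorem mem_rowsOf {R : Finset Role} {r : Row} : r ∈ rowsOf R ↔ r.role ∈ R := by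
  simp [rowsOf]

/-- The full roles of `rowsOf R` are `R`. [folklore] -/
theorem fullRoles_rowsOf (R : Finset Role) : fullRoles (rowsOf R) = R := by
  ext x
  rw [mem_fullRoles]
  constructor
  · intro h
    simpa using h (someRow x) (role_someRow x)
  · intro hx r hr
    exact mem_rowsOf.mpr (hr ▸ hx)

/-- `rowsOf R` is a cover iff `R` is a role cover.
[cite: Zhang2022LandauSiegel, §2 (2.18)–(2.19), Props. 2.4–2.5, (2.32)–(2.33)] -/
theorem isCover_rowsOf_iff (R : Finset Role) : IsCover (rowsOf R) ↔ IsRoleCover R := by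
  rw [isCover_iff_isRoleCover, fullRoles_rowsOf]

/-- **Every cover contains all rows of one of the eight role covers.**
[cite: Zhang2022LandauSiegel, §2 (2.18)–(2.19), Props. 2.4–2.5, (2.32)–(2.33)] -/
theorem exists_rowsOf_subset {H : Finset Row} (h : IsCover H) : ∃ C ∈ roleCovers, rowsOf C ⊆ H := by
  obtain ⟨C, hC, hsub⟩ := exists_roleCover_subset ((isCover_iff_isRoleCover H).mp h)
  exact ⟨C, hC, fun r hr => (mem_fullRoles.mp (hsub (mem_rowsOf.mp hr))) r rfl⟩

/-- **The minimal covers are exactly the eight sets `rowsOf RCk`.**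
[cite: Zhang2022LandauSiegel, §2 (2.18)–(2.19), Props. 2.4–2.5, (2.32)–(2.33)] -/
theorem isMinimalCover_iff (H : Finset Row) : IsMinimalCover H ↔ ∃ C ∈ roleCovers, H = rowsOf C := by
  constructor
  · rintro ⟨hH, hmin⟩
    obtain ⟨C, hC, hsub⟩ := exists_rowsOf_subset hH
    refine ⟨C, hC, ?_⟩
    by_contra hne
    have hnot : ¬ H ⊆ rowsOf C := fun h' => hne (Finset.Subset.antisymm h' hsub)
    obtain ⟨r, hrH, hrC⟩ := Finset.not_subset.mp hnot
    refine hmin r hrH (isCover_mono (fun s hs => ?_)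
      ((isCover_rowsOf_iff C).mpr (roleCovers_minimal C hC).1))
    exact Finset.mem_erase.mpr ⟨fun hsr => hrC (hsr ▸ hs), hsub hs⟩
  · rintro ⟨C, hC, rfl⟩
    refine ⟨(isCover_rowsOf_iff C).mpr (roleCovers_minimal C hC).1, fun r hr hcov => ?_⟩
    have hrole : r.role ∈ C := mem_rowsOf.mp hr
    refine (roleCovers_minimal C hC).2 r.role hrole
      (isRoleCover_mono (fun x hx => ?_) ((isCover_iff_isRoleCover _).mp hcov))
    rw [mem_fullRoles] at hx
    refine Finset.mem_erase.mpr ⟨?_, ?_⟩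
    · rintro rfl
      exact (Finset.mem_erase.mp (hx r rfl)).1 rfl
    · have hmem := (Finset.mem_erase.mp (hx (someRow x) (role_someRow x))).2
      simpa using mem_rowsOf.mp hmem

/-- The eight minimal covers, row by row (JSON ids in `TerminalBlockIIS`): RC1 ↦ the three certified
(2.32)-floor rows `N-2.32Gs`, `N-2.32s`, `N-III.18sum`; RC2 ↦ the four (2.33) rows `III-18.03f`,
`N-2.33n`, `N-2.33s`, `N-II.2.33a`; RC3 ↦ the three thr24-cap rows `N-II.10.17a`, `N-P2.4n`,
`N-P2.4s`; RC4 ↦ `I-2.32a`, `III-2.P25a`, `N-P2.5s`; RC5 ↦ `I-T9a`, `III-2.asm`, `N-P2.5s`; RC6 ↦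
`I-P2.5a`, `III-2.P25b`, `N-P2.5s`; RC7 ↦ `N-P2.4n`, `N-P2.4s`, `I-P2.4a`, `I-T9a`, `III-2.asm`;
RC8 ↦ `N-P2.4n`, `N-P2.4s`, `I-P2.4a`, `I-P2.5a`, `III-2.P25b`.
[cite: Zhang2022LandauSiegel, §2 (2.18)–(2.19), Props. 2.4–2.5, (2.32)–(2.33), §10 (10.17), §18
(18.2)–(18.3)] -/
theorem rowsOf_roleCovers :
    rowsOf RC1 = {.N_2_32Gs, .N_2_32s, .N_III_18sum} ∧
    rowsOf RC2 = {.III_18_03f, .N_2_33n, .N_2_33s, .N_II_2_33a} ∧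
    rowsOf RC3 = {.N_II_10_17a, .N_P2_4n, .N_P2_4s} ∧
    rowsOf RC4 = {.I_2_32a, .III_2_P25a, .N_P2_5s} ∧
    rowsOf RC5 = {.I_T9a, .III_2_asm, .N_P2_5s} ∧
    rowsOf RC6 = {.I_P2_5a, .III_2_P25b, .N_P2_5s} ∧
    rowsOf RC7 = {.N_P2_4n, .N_P2_4s, .I_P2_4a, .I_T9a, .III_2_asm} ∧
    rowsOf RC8 = {.N_P2_4n, .N_P2_4s, .I_P2_4a, .I_P2_5a, .III_2_P25b} := by
  decide

/-- Sizes of the eight minimal covers: 3, 4, 3, 3, 3, 3, 5, 5.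
[cite: Zhang2022LandauSiegel, §2 (2.18)–(2.19), Props. 2.4–2.5, (2.32)–(2.33)] -/
theorem card_rowsOf_roleCovers :
    roleCovers.map (fun C => (rowsOf C).card) = [3, 4, 3, 3, 3, 3, 5, 5] := by
  decide

/-- **Every repair touches at least three rows** (and five of the eight minimal covers have exactly
three). [cite: Zhang2022LandauSiegel, §2 (2.18)–(2.19), Props. 2.4–2.5, (2.32)–(2.33)] -/
theorem three_le_card_of_isCover {H : Finset Row} (h : IsCover H) : 3 ≤ H.card := by
  obtain ⟨C, hC, hsub⟩ := exists_rowsOf_subset h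
  have h3 : ∀ C ∈ roleCovers, 3 ≤ (rowsOf C).card := by
    simp only [roleCovers, List.mem_cons, List.not_mem_nil, or_false, forall_eq_or_imp, forall_eq]
    decide
  exact (h3 C hC).trans (Finset.card_le_card hsub)

/-- No single row and no pair of rows is a cover; in particular deleting only the printed-premise
row `III-18.02b`, or only the two (2.32)-floor rows at the printed ι, does not restore consistency.
[cite: Zhang2022LandauSiegel, §2 (2.18)–(2.19), Props. 2.4–2.5, (2.32)–(2.33)] -/
theorem not_isCover_of_card_le_two {H : Finset Row} (h : H.card ≤ 2) : ¬ IsCover H :=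
  fun hH => absurd ((three_le_card_of_isCover hH).trans h) (by decide)

/-- The catalogue of minimal covers. [cite: Zhang2022LandauSiegel, §2 (2.18)–(2.19), Props.
2.4–2.5, (2.32)–(2.33)] -/
def minimalCovers : Finset (Finset Row) := (roleCovers.map rowsOf).toFinset

/-- `minimalCovers` is exactly the set of minimal covers.
[cite: Zhang2022LandauSiegel, §2 (2.18)–(2.19), Props. 2.4–2.5, (2.32)–(2.33)] -/
theorem mem_minimalCovers_iff (H : Finset Row) : H ∈ minimalCovers ↔ IsMinimalCover H := by
  rw [isMinimalCover_iff, minimalCovers, List.mem_toFinset, List.mem_map]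
  constructor
  · rintro ⟨C, hC, hEq⟩
    exact ⟨C, hC, hEq.symm⟩
  · rintro ⟨C, hC, hEq⟩
    exact ⟨C, hC, hEq.symm⟩

/-- **Eight minimal covers** (the cell's exact enumeration: `sweep/sweep-2/iis_cover_v9_out.json`,
Berge's algorithm on the 372 minimal IIS = brute force over all row sets of size ≤ 7).
[cite: Zhang2022LandauSiegel, §2 (2.18)–(2.19), Props. 2.4–2.5, (2.32)–(2.33)] -/
theorem card_minimalCovers : minimalCovers.card = 8 := by
  decide

/-- `III-18.02b` — the manuscript's own value of (18.2), role `L232p` — lies in no minimal cover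
(dually: in no minimal IIS, `TerminalBlockIIS.not_feasible_erase_iff`).
[cite: Zhang2022LandauSiegel, §18 (18.2)] -/
theorem not_mem_of_isMinimalCover {H : Finset Row} (h : IsMinimalCover H) : Row.III_18_02b ∉ H := by
  obtain ⟨C, hC, rfl⟩ := (isMinimalCover_iff H).mp h
  have key : ∀ C ∈ roleCovers, Row.III_18_02b ∉ rowsOf C := by
    simp only [roleCovers, List.mem_cons, List.not_mem_nil, or_false, forall_eq_or_imp, forall_eq]
    decide
  exact key C hC

/-! ## Maximal feasible subsystems -/

/-- Inserting a row of `H` into the complement of `H` is deleting one row fewer. [folklore] -/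
theorem insert_univ_sdiff {H : Finset Row} {r : Row} (hr : r ∈ H) :
    insert r (Finset.univ \ H) = Finset.univ \ H.erase r := by
  ext s
  simp only [Finset.mem_insert, Finset.mem_sdiff, Finset.mem_univ, true_and, Finset.mem_erase,
    not_and]
  constructor
  · rintro (rfl | hs) hne
    · exact absurd rfl hne
    · exact hs
  · intro h
    by_cases hsr : s = r
    · exact Or.inl hsr
    · exact Or.inr (h hsr)

/-- **Duality of extremal objects.** The complement of `H` is a maximal feasible subsystem iff `H`
is a minimal cover. [folklore] -/
theorem isMaximalFeasible_compl_iff (H : Finset Row) :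
    IsMaximalFeasible (Finset.univ \ H) ↔ IsMinimalCover H := by
  constructor
  · rintro ⟨hF, hmax⟩
    refine ⟨hF, fun r hr hcov => ?_⟩
    have hr' : r ∉ Finset.univ \ H := fun h => (Finset.mem_sdiff.mp h).2 hr
    refine hmax r hr' ?_
    rw [insert_univ_sdiff hr]
    exact hcov
  · rintro ⟨hH, hmin⟩
    refine ⟨hH, fun r hr hF => ?_⟩
    have hrH : r ∈ H := by
      by_contra h'
      exact hr (Finset.mem_sdiff.mpr ⟨Finset.mem_univ r, h'⟩)
    refine hmin r hrH ?_
    unfold IsCover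
    rw [← insert_univ_sdiff hrH]
    exact hF

/-- **The maximal feasible subsystems are exactly the eight complements** `univ \ rowsOf RCk` — the
row sets served by the witnesses `W5`, `W7`, `W6`, … of `TerminalBlockIIS` (one per maximal
pattern-free role set). [cite: Zhang2022LandauSiegel, §2 (2.18)–(2.19), Props. 2.4–2.5,
(2.32)–(2.33)] -/
theorem isMaximalFeasible_iff (S : Finset Row) :
    IsMaximalFeasible S ↔ ∃ C ∈ roleCovers, S = Finset.univ \ rowsOf C := by
  have hS : Finset.univ \ (Finset.univ \ S) = S := by
    ext r; simp
  rw [← hS, isMaximalFeasible_compl_iff, isMinimalCover_iff, hS]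
  constructor
  · rintro ⟨C, hC, h⟩
    refine ⟨C, hC, ?_⟩
    rw [← h, hS]
  · rintro ⟨C, hC, rfl⟩
    refine ⟨C, hC, ?_⟩
    ext r; simp

/-- The largest maximal feasible subsystems have 16 of the 19 rows (drop a 3-row cover), the smallest
14 (drop a 5-row cover). [cite: Zhang2022LandauSiegel, §2 (2.18)–(2.19), Props. 2.4–2.5,
(2.32)–(2.33)] -/
theorem card_univ_sdiff_rowsOf_roleCovers :
    roleCovers.map (fun C => (Finset.univ \ rowsOf C).card) = [16, 15, 16, 16, 16, 16, 14, 14] := by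
  decide

end TerminalBlock

end Literature.NumberTheory.LFunctions.Zhang2022
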